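import Mathlib.Analysis.Convex.Hull
import Mathlib.Analysis.SpecialFunctions.Pow.Real
import Mathlib.Order.Filter.AtTopBot.Basic
import Literature.Barriers.PneNP.TSPExtensionComplexity
import Literature.Barriers.PneNP.TSPExtensionComplexityFaces
import Literature.Barriers.PneNP.ExtendedFormulationLinearImage
import Literature.Combinatorics.Optimization.CutTspStabPsdRank
import Literature.Combinatorics.SimpleGraph.KuratowskiPlanarity
import HarnessLib

/-!
# Cut polytopes of graphs: minor-monotone extension complexity, the stable set polytope as a
# projected face of the cut polytope of the suspension, and cubic planar graphs with
# `xc(STAB) ≥ 2^{Ω(n^{1/4})}` (Avis–Tiwary 2015)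

[topic Combinatorics/Optimization]

TYPED STATEMENTS (named facts, not proved here) from D. Avis, H. R. Tiwary, *On the extension
complexity of combinatorial polytopes*, Math. Program. 153 (2015) 95–115 = arXiv:1302.2340
[AvisTiwary2015] (held text `paper:arxiv-1302.2340`; locators below are section / statement
numbers of the paper and `pNNNN Lk` = chunk/line of the lit-read materialisation), in the
extension-complexity currency of the tree (`Literature.Barriers.PneNP.HasEFOfSize P r`: "`P` is the
projection of a slack-form system `E x + F y = g, y ≥ 0` with `r` sign-constrained variables", so
that "`xc(P) ≤ xc(Q)`" reads `∀ r, HasEFOfSize Q r → HasEFOfSize P r` and "`xc(P) ≥ 2^{f(n)}`" reads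
`∀ r, HasEFOfSize P r → 2^{f(n)} ≤ r`, exactly as in `TSPExtensionComplexity` / `Rothvoss2017_tsp`).

**Printed definitions (§2.1, p0005 L19–34).** "The cut polytope of a graph `G = (V, E)`, denoted
`CUT□(G)`, is the convex hull of the cut vectors `δ_G(S)` of `G` defined by all the subsets `S ⊆ V`
in the `|E|`-dimensional vector space `ℝ^E`. The cut vector `δ_G(S)` of `G` defined by `S ⊆ V` is a
vector in `ℝ^E` whose `uv`-coordinate is defined as follows: `δ_uv(S) = 1` if `|S ∩ {u, v}| = 1`,
`0` otherwise, for `uv ∈ E`. If `G` is the complete graph `K_n`, we simply denote `CUT□(K_n)` by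
`CUT□_n`." — `cutVec G S : G.edgeSet → ℝ` and `cutPolytope G = conv{cutVec G S : S ⊆ V}` below
(for `G = ⊤` on `Fin n` these are the `cutVector S` / `conv(range cutVector)` of
`CutTspStabPsdRank.lean`, by unfolding). The stable set polytope `STAB(G) = conv{𝟙_S : S stable}`
(§2.2 / [FMPTW]) is `stabPolytope G = conv(range stableSetVector)`, REUSING the tree's stable-set
vertex family `StableSets G` / `stableSetVector` (`CutTspStabPsdRank.lean`, `G : SimpleGraph (Fin n)`).
Size of an extension = number of facets of the extension polytope, `xc(P)` = its minimum over all
extensions (§2.2, p0005 L125) — the same number as the minimum number of inequalities of an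
extended formulation [FMPTW, §1/§3], which is what `HasEFOfSize` counts. "Proposition 1. If `P` is
a projection of `Q` then `xc(P) ≤ xc(Q)`. Proposition 2. If `P` is a face of `Q` then
`xc(P) ≤ xc(Q)`." (p0006 L108–110).

**Typed here.**
* `AvisTiwary2015_thm12` — **Theorem 12** (§4.1, p0013 L22–24): "Let `G` be a graph and `H` be a
  minor of `G`. Then `xc(CUT□(G)) ≥ xc(CUT□(H))`." (from Lemma 3, edge deletion: "`CUT□(G)` is an
  extension of `CUT□(H)`"; Lemma 4, vertex deletion: likewise; Lemma 5, contraction of `e`: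
  "`CUT□(H)` is the projection of a face of `CUT□(G)`", the face `CUT□(G) ∩ {x_e = 0}`; p0012 L104 –
  p0013 L20; minors as in §4.1, p0012 L96–98: "A graph `H` is a minor of a graph `G` if `H` can be
  obtained from `G` by contracting some edges, deleting some edges and isolated vertices, and
  relabeling" = the tree's branch-set notion `IsMinor`, `SubcubicMinors.lean`).
* `AvisTiwary2015_thm13` — **Theorem 13** (§4.2, p0013 L48–50): "Consider the suspension `G'` of
  `G` obtained by adding an extra vertex labelled `0` with edges to all vertices `V`. Theorem 13.
  Let `G = (V, E)` be a graph and let `G'` be a suspension over `G`. Then `STAB(G)` is the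
  projection of a face of `CUT□(G')`." A face of the polytope `Q` = `Q ∩ {x | c·x = δ}` for an
  inequality `c·x ≤ δ` valid on `Q` (every face of a polytope is of this form); a projection = the
  image under a linear map (the printed proof projects the face
  `CUT□(G') ∩ ⋂_{(i,j) ∈ E} {x_{0i} + x_{0j} − x_{ij} = 0}` onto the coordinates `x_{01}, …, x_{0n}`).
  **PROVED** (`AvisTiwary2015_thm13_holds`, section `AvisTiwary2015Thm13` at the end of the file: the
  valid form `c·x = −Σ_{k∼l}(x_{0k} + x_{0l} − x_{kl}) ≤ 0`, its face, and the apex-coordinate projection, exactly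
  as printed; `⊆` by lifting stable sets to cuts with the apex on the far side, `⊇` by writing a point of
  the face as a convex combination of cut vectors, on whose support every `h_e` vanishes).
* `AvisTiwary2015_cor5` — **Corollary 5** (§3.2, p0011 L13): "For every natural number `n ≥ 1`
  there exists a cubic planar graph `G` with `O(n)` vertices and edges such that
  `xc(STAB(G)) ≥ 2^{Ω(n^{1/4})}`." `Ω`/`O` unfolded as constants `c > 0`, `C` and an eventual
  range of `n` (`∀ᶠ n in atTop`), the currency of `TSPExtensionComplexity`; cubic = every vertex
  has exactly three neighbours; planar = the tree's `IsPlanar` (Kuratowski form,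
  `KuratowskiPlanarity.lean`).

Theorem 14 (p0013 L67–69: "For every `n ≥ 2` there exists a graph `G` which is a suspension of a
planar graph and for which `xc(CUT□(G)) ≥ 2^{Ω(n^{1/4})}`") is deliberately NOT typed: as printed
it does not say that the planar graph has `n` vertices (only its proof, L72–74, does), and the
sized statement follows from Cor. 5 + Thm. 13 + Props. 1–2 (`HasEFOfSize.inter_eqs`, image lemmas
of `TSPExtensionComplexityFaces.lean`).

## References

* [AvisTiwary2015] D. Avis, H. R. Tiwary, *On the extension complexity of combinatorial polytopes*,
  Math. Program. 153 (2015) 95–115, doi:10.1007/s10107-014-0764-2 = arXiv:1302.2340; §2.1, §3.2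
  (Cor. 5), §4.1 (Lemmas 3–5, Thm. 12), §4.2 (Thm. 13, Thm. 14). Read: held text, chunks p0005,
  p0006, p0010–p0013.
* [FioriniEtAl2015] S. Fiorini, S. Massar, S. Pokutta, H. R. Tiwary, R. de Wolf, *Exponential lower
  bounds for polytopes in combinatorial optimization*, J. ACM 62 (2015) — extended formulations,
  `xc`, `STAB(G)` (the currency; see `TSPExtensionComplexity.lean`).
-/

noncomputable section

namespace Literature.Combinatorics.Optimization

open Matrix Finset Filter
open Literature.Barriers.PneNP (HasEFOfSize)
open Literature.Combinatorics.SimpleGraph (IsMinor IsPlanar suspension)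

variable {V : Type} [DecidableEq V]

/-! ### Cut vectors and the cut polytope of a graph (§2.1) -/

/-- `𝟙[|S ∩ {u,v}| = 1]` on unordered pairs: exactly one of `u, v` lies in `S` (the general-vertex-type
form of `cutIndicator` of `CutTspStabPsdRank.lean`). [cite: AvisTiwary2015, §2.1 (p0005 L25–30)] -/
def cutInd (S : Finset V) : Sym2 V → Bool :=
  Sym2.lift ⟨fun u v => xor (decide (u ∈ S)) (decide (v ∈ S)), fun _ _ => Bool.xor_comm _ _⟩

/-- `cutInd` on a pair, unfolded. [cite: AvisTiwary2015, §2.1 (p0005 L25–30)] -/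
theorem cutInd_mk (S : Finset V) (u v : V) :
    cutInd S s(u, v) = xor (decide (u ∈ S)) (decide (v ∈ S)) := rfl

/-- **The cut vector** `δ_G(S) ∈ ℝ^E` of `S ⊆ V`: its `uv`-coordinate (`uv ∈ E`) is `1` if
`|S ∩ {u, v}| = 1` and `0` otherwise. [cite: AvisTiwary2015, §2.1 (p0005 L23–30)] -/
def cutVec (G : SimpleGraph V) (S : Finset V) : G.edgeSet → ℝ :=
  fun e => if cutInd S (e : Sym2 V) then 1 else 0

/-- The cut vector, unfolded at an edge `uv`. [cite: AvisTiwary2015, §2.1 (p0005 L25–30)] -/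
theorem cutVec_apply_mk (G : SimpleGraph V) (S : Finset V) (u v : V) (h : s(u, v) ∈ G.edgeSet) :
    cutVec G S ⟨s(u, v), h⟩ = if xor (decide (u ∈ S)) (decide (v ∈ S)) then 1 else 0 := rfl

/-- Entries of a cut vector are `0` or `1`. [cite: AvisTiwary2015, §2.1 (p0005 L44–48: "the cut vector is the incidence vector of the cut set")] -/
theorem cutVec_zero_or_one (G : SimpleGraph V) (S : Finset V) (e : G.edgeSet) :
    cutVec G S e = 0 ∨ cutVec G S e = 1 := by
  unfold cutVec; split_ifs <;> simp

/-- A set and its complement define the same cut vector. [cite: AvisTiwary2015, §2.1 (p0005 L25–30)] -/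
theorem cutVec_compl [Fintype V] (G : SimpleGraph V) (S : Finset V) : cutVec G Sᶜ = cutVec G S := by
  funext e
  obtain ⟨e, he⟩ := e
  induction e using Sym2.ind with
  | _ u v =>
    by_cases hu : u ∈ S <;> by_cases hv : v ∈ S <;> simp [cutVec, cutInd_mk, hu, hv]

/-- **The cut polytope** `CUT□(G) ⊆ ℝ^E` of a graph `G = (V, E)`: the convex hull of the cut vectors
`δ_G(S)`, `S ⊆ V`. [cite: AvisTiwary2015, §2.1 (p0005 L21–24)] -/
def cutPolytope (G : SimpleGraph V) : Set (G.edgeSet → ℝ) :=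
  convexHull ℝ (Set.range (cutVec G))

/-- Cut vectors lie in the cut polytope. [cite: AvisTiwary2015, §2.1 (p0005 L21–24)] -/
theorem cutVec_mem_cutPolytope (G : SimpleGraph V) (S : Finset V) : cutVec G S ∈ cutPolytope G :=
  subset_convexHull ℝ _ ⟨S, rfl⟩

/-- The cut polytope is convex. [cite: AvisTiwary2015, §2.1 (p0005 L21–24)] -/
theorem convex_cutPolytope (G : SimpleGraph V) : Convex ℝ (cutPolytope G) :=
  convex_convexHull ℝ _

/-! ### The stable set polytope (vertex family of `CutTspStabPsdRank.lean`) -/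

/-- **The stable set polytope** `STAB(G) = conv{𝟙_S : S ⊆ V stable} ⊆ ℝ^V` of a graph on
`V = Fin n`, as the convex hull of the tree's stable-set vectors `stableSetVector`
(`StableSets G` = vertex sets with no edge inside). [cite: AvisTiwary2015, §2.2 and §3 (p0006 L94–96, p0010 L8–11: `STAB(G)`); FioriniEtAl2015, §3] -/
def stabPolytope {n : ℕ} (G : SimpleGraph (Fin n)) : Set (Fin n → ℝ) :=
  convexHull ℝ (Set.range (stableSetVector (G := G)))

/-- Stable-set vectors lie in the stable set polytope. [cite: AvisTiwary2015, §3 (p0010 L8–11)] -/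
theorem stableSetVector_mem_stabPolytope {n : ℕ} {G : SimpleGraph (Fin n)} (S : StableSets G) :
    stableSetVector S ∈ stabPolytope G :=
  subset_convexHull ℝ _ ⟨S, rfl⟩

/-- The stable set polytope is convex. [cite: AvisTiwary2015, §3 (p0010 L8–11)] -/
theorem convex_stabPolytope {n : ℕ} (G : SimpleGraph (Fin n)) : Convex ℝ (stabPolytope G) :=
  convex_convexHull ℝ _

/-! ### The named facts -/

/-- **Avis–Tiwary 2015, Theorem 12 (extension complexity of cut polytopes is minor-monotone).**
"Let `G` be a graph and `H` be a minor of `G`. Then `xc(CUT□(G)) ≥ xc(CUT□(H))`." Here: for finite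
graphs `H` (on `α`) and `G` (on `β`) with `H` a minor of `G` (the tree's `IsMinor`, branch-set
form — the textbook equivalent of "obtained by contracting some edges, deleting some edges and
isolated vertices, and relabeling", §4.1), every size `r` of an extended formulation of `CUT□(G)`
is also one of `CUT□(H)`, i.e. `xc(CUT□(H)) ≤ xc(CUT□(G))`. Printed proof: Lemma 3 (deleting an
edge: `CUT□(G)` is an extension of `CUT□(H)`), Lemma 4 (deleting a vertex: the same), Lemma 5
(contracting an edge `e`: `CUT□(H)` is the projection of the face `CUT□(G) ∩ {x_e = 0}`), with
Propositions 1 and 2. NOT proved here.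
[cite: AvisTiwary2015, Thm. 12 (§4.1; arXiv p. 13, lit-read p0013 L22–24; Lemmas 3–5 p0012 L104 – p0013 L20; minors p0012 L96–98)] -/
def AvisTiwary2015_thm12 : Prop :=
  ∀ (α β : Type) [Fintype α] [DecidableEq α] [Fintype β] [DecidableEq β]
    (H : SimpleGraph α) (G : SimpleGraph β) [DecidableRel H.Adj] [DecidableRel G.Adj],
    IsMinor H G → ∀ r : ℕ, HasEFOfSize (cutPolytope G) r → HasEFOfSize (cutPolytope H) r

/-- **Avis–Tiwary 2015, Theorem 13 (the stable set polytope is a projected face of the cut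
polytope of the suspension).** "Consider the suspension `G'` of `G` obtained by adding an extra
vertex labelled `0` with edges to all vertices `V`. Theorem 13. Let `G = (V, E)` be a graph and
let `G'` be a suspension over `G`. Then `STAB(G)` is the projection of a face of `CUT□(G')`."
Here, for `G` on `V = Fin n` and `G' = suspension G` (apex `none`): there are an inequality
`c·x ≤ δ` valid on `CUT□(G')` and a linear map `π : ℝ^{E(G')} → ℝ^V` with
`STAB(G) = π(CUT□(G') ∩ {c·x = δ})`. (Printed proof: the face
`F = CUT□(G') ∩ ⋂_{(i,j) ∈ E} {x_{0i} + x_{0j} − x_{ij} = 0}` — one tight valid inequality per edge,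
equivalently their sum — projected onto `x_{01}, …, x_{0n}`.) PROVED below:
`AvisTiwary2015_thm13_holds` (appended 2026-08-28, following the printed proof).
[cite: AvisTiwary2015, Thm. 13 (§4.2; arXiv p. 13, lit-read p0013 L48–50, proof L52–62)] -/
def AvisTiwary2015_thm13 : Prop :=
  ∀ (n : ℕ) (G : SimpleGraph (Fin n)) [DecidableRel G.Adj],
    ∃ (c : (suspension G).edgeSet → ℝ) (δ : ℝ),
      (∀ x ∈ cutPolytope (suspension G), c ⬝ᵥ x ≤ δ) ∧
      ∃ π : ((suspension G).edgeSet → ℝ) →ₗ[ℝ] (Fin n → ℝ),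
        stabPolytope G = π '' (cutPolytope (suspension G) ∩ {x | c ⬝ᵥ x = δ})

/-- **Avis–Tiwary 2015, Corollary 5 (cubic planar graphs whose stable set polytopes need
`2^{Ω(n^{1/4})}` inequalities).** "For every natural number `n ≥ 1` there exists a cubic planar
graph `G` with `O(n)` vertices and edges such that `xc(STAB(G)) ≥ 2^{Ω(n^{1/4})}`." Unfolding
`O`/`Ω`: there are `c > 0` and `C` such that for all sufficiently large `n` some graph `G` on
`m ≤ C·n` vertices with at most `C·n` edges, cubic (every vertex has exactly `3` neighbours) and
planar (`IsPlanar`, Kuratowski form), has `2^{c·n^{1/4}} ≤ r` for every size `r` of an extended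
formulation of `STAB(G)`. (Printed route: [FMPTW] Thm. 8 (`2^{Ω(√n)}` for some `O(n)`-size graph),
Thm. 9 (planarising gadget, `O(n²)` blow-up = Cor. 4: planar, `2^{Ω(n^{1/4})}`), Thm. 11 (degree
reduction gadgets ReduceDegree / RemoveBridge / RemoveTerminal), Props. 1–2.) NOT proved here.
[cite: AvisTiwary2015, Cor. 5 (§3.2; arXiv p. 11, lit-read p0011 L11–13)] -/
def AvisTiwary2015_cor5 : Prop :=
  ∃ c : ℝ, 0 < c ∧ ∃ C : ℕ, ∀ᶠ n : ℕ in atTop, ∃ m : ℕ, m ≤ C * n ∧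
    ∃ G : SimpleGraph (Fin m),
      (∀ v, (G.neighborSet v).ncard = 3) ∧ Nat.card G.edgeSet ≤ C * n ∧ IsPlanar G ∧
      ∀ r : ℕ, HasEFOfSize (stabPolytope G) r → (2 : ℝ) ^ (c * (n : ℝ) ^ ((1 : ℝ) / 4)) ≤ r

end Literature.Combinatorics.Optimization

/-! ## Proof of Theorem 13 (appended) -/

namespace Literature.Combinatorics.Optimization

open Matrix Finset
open Literature.Barriers.PneNP (HasEFOfSize)
open Literature.Combinatorics.SimpleGraph (IsMinor IsPlanar suspension suspension_adj_none_some
  suspension_adj_some_some)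

namespace AvisTiwary2015Thm13

variable {n : ℕ} (G : SimpleGraph (Fin n))

/-- The apex edge `0i` of the suspension, as a coordinate of `ℝ^{E(G')}`. [cite: AvisTiwary2015, Thm. 13 proof (p0013 L52–62)] -/
private def apexE (i : Fin n) : (suspension G).edgeSet :=
  ⟨s(none, some i), (SimpleGraph.mem_edgeSet _).2 (suspension_adj_none_some G i)⟩

/-- An edge `kl` of `G`, as a coordinate of `ℝ^{E(G')}`. [cite: AvisTiwary2015, Thm. 13 proof (p0013 L52–62)] -/
private def liftE (k l : Fin n) (h : G.Adj k l) : (suspension G).edgeSet :=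
  ⟨s(some k, some l), (SimpleGraph.mem_edgeSet _).2 ((suspension_adj_some_some G k l).2 h)⟩

/-- The projection onto the apex coordinates `x ↦ (x_{01}, …, x_{0n})`. [cite: AvisTiwary2015, Thm. 13 proof (p0013 L60–62)] -/
private def proj : ((suspension G).edgeSet → ℝ) →ₗ[ℝ] (Fin n → ℝ) :=
  LinearMap.pi fun i => LinearMap.proj (apexE G i)

/-- Helper for the proof of Theorem 13. [folklore] -/
private theorem proj_apply (x : (suspension G).edgeSet → ℝ) (i : Fin n) : proj G x i = x (apexE G i) := rfl

/-- Values of a cut vector of the suspension on the two kinds of coordinates. [folklore] -/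
private theorem cutVec_apexE (S : Finset (Option (Fin n))) (i : Fin n) :
    cutVec (suspension G) S (apexE G i) =
      if xor (decide (none ∈ S)) (decide (some i ∈ S)) then 1 else 0 := rfl

/-- Helper for the proof of Theorem 13. [folklore] -/
private theorem cutVec_liftE (S : Finset (Option (Fin n))) {k l : Fin n} (h : G.Adj k l) :
    cutVec (suspension G) S (liftE G k l h) =
      if xor (decide (some k ∈ S)) (decide (some l ∈ S)) then 1 else 0 := rfl

/-- The cut of the suspension defined by a vertex set `S ⊆ V` (apex on the other side). [folklore] -/
private def liftSet (S : Finset (Fin n)) : Finset (Option (Fin n)) := S.map Function.Embedding.some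

/-- Helper for the proof of Theorem 13. [folklore] -/
private theorem none_not_mem_liftSet (S : Finset (Fin n)) : (none : Option (Fin n)) ∉ liftSet S := by
  simp [liftSet]

/-- Helper for the proof of Theorem 13. [folklore] -/
private theorem some_mem_liftSet (S : Finset (Fin n)) (i : Fin n) : some i ∈ liftSet S ↔ i ∈ S := by
  simp [liftSet]

/-- Helper for the proof of Theorem 13. [folklore] -/
private theorem proj_cutVec_liftSet (S : StableSets G) :
    proj G (cutVec (suspension G) (liftSet S.1)) = stableSetVector S := by
  funext i
  rw [proj_apply, cutVec_apexE]
  simp only [none_not_mem_liftSet, decide_false, some_mem_liftSet, Bool.false_xor,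
    decide_eq_true_eq]
  rfl

/-- The vertex set read off the apex coordinates of a `0/1` point. [folklore] -/
private def readSet (y : (suspension G).edgeSet → ℝ) : Finset (Fin n) :=
  Finset.univ.filter fun i => y (apexE G i) = 1

/-- Evaluation at a coordinate, as a linear form. [folklore] -/
private def ev (e : (suspension G).edgeSet) : ((suspension G).edgeSet → ℝ) →ₗ[ℝ] ℝ :=
  LinearMap.proj (R := ℝ) (φ := fun _ : (suspension G).edgeSet => ℝ) e

/-- Helper for the proof of Theorem 13. [folklore] -/
private theorem ev_apply (e : (suspension G).edgeSet) (x : (suspension G).edgeSet → ℝ) : ev G e x = x e := rfl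

section Valid

variable [DecidableRel G.Adj]

/-- The valid linear form `h_e(x) = x_{0k} + x_{0l} - x_{kl}` of an (ordered) edge `e = kl` of `G`
(zero when `k, l` are not adjacent). [cite: AvisTiwary2015, Thm. 13 proof (p0013 L56–58)] -/
private def tri (k l : Fin n) : ((suspension G).edgeSet → ℝ) →ₗ[ℝ] ℝ :=
  if h : G.Adj k l then ev G (apexE G k) + ev G (apexE G l) - ev G (liftE G k l h) else 0

/-- `Φ = Σ_{k,l} h_{kl}` — the sum of the forms over ordered adjacent pairs (each edge twice).
[cite: AvisTiwary2015, Thm. 13 proof (p0013 L58–59: the face `F`)] -/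
private def Phi : ((suspension G).edgeSet → ℝ) →ₗ[ℝ] ℝ :=
  ∑ k, ∑ l, tri G k l

/-- Helper for the proof of Theorem 13. [folklore] -/
private theorem tri_apply_of_adj {k l : Fin n} (h : G.Adj k l) (x : (suspension G).edgeSet → ℝ) :
    tri G k l x = x (apexE G k) + x (apexE G l) - x (liftE G k l h) := by
  rw [tri, dif_pos h]
  rfl

/-- Helper for the proof of Theorem 13. [folklore] -/
private theorem tri_apply_of_not_adj {k l : Fin n} (h : ¬ G.Adj k l) (x : (suspension G).edgeSet → ℝ) :
    tri G k l x = 0 := by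
  rw [tri, dif_neg h, LinearMap.zero_apply]

/-- Helper for the proof of Theorem 13. [folklore] -/
private theorem Phi_apply (x : (suspension G).edgeSet → ℝ) : Phi G x = ∑ k, ∑ l, tri G k l x := by
  simp [Phi, LinearMap.sum_apply]

/-- `h_e ≥ 0` on every cut vector (the triangle inequality for cuts). [cite: AvisTiwary2015, Thm. 13 proof (p0013 L56: "h_e is a valid inequality for CUT□(G')")] -/
private theorem tri_cutVec_nonneg (S : Finset (Option (Fin n))) (k l : Fin n) :
    0 ≤ tri G k l (cutVec (suspension G) S) := by
  by_cases h : G.Adj k l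
  · rw [tri_apply_of_adj G h, cutVec_apexE, cutVec_apexE, cutVec_liftE]
    by_cases h0 : none ∈ S <;> by_cases hk : some k ∈ S <;> by_cases hl : some l ∈ S <;>
      simp [h0, hk, hl]
  · rw [tri_apply_of_not_adj G h]

/-- Helper for the proof of Theorem 13. [folklore] -/
private theorem Phi_cutVec_nonneg (S : Finset (Option (Fin n))) : 0 ≤ Phi G (cutVec (suspension G) S) := by
  rw [Phi_apply]
  exact Finset.sum_nonneg fun k _ => Finset.sum_nonneg fun l _ => tri_cutVec_nonneg G S k l

/-- `Φ ≥ 0` on the cut polytope. [folklore] -/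
private theorem Phi_nonneg_of_mem {x : (suspension G).edgeSet → ℝ} (hx : x ∈ cutPolytope (suspension G)) :
    0 ≤ Phi G x := by
  have hconv : Convex ℝ {w : (suspension G).edgeSet → ℝ | (0 : ℝ) ≤ Phi G w} :=
    convex_halfSpace_ge (Phi G).isLinear 0
  refine (convexHull_min ?_ hconv) hx
  rintro _ ⟨S, rfl⟩
  exact Phi_cutVec_nonneg G S

/-- If `Φ` vanishes at a cut vector then every `h_{kl}` does. [folklore] -/
private theorem tri_cutVec_eq_zero_of_Phi {S : Finset (Option (Fin n))} (h0 : Phi G (cutVec (suspension G) S) = 0)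
    (k l : Fin n) : tri G k l (cutVec (suspension G) S) = 0 := by
  rw [Phi_apply] at h0
  have h1 := (Finset.sum_eq_zero_iff_of_nonneg fun k _ =>
    Finset.sum_nonneg fun l _ => tri_cutVec_nonneg G S k l).1 h0 k (Finset.mem_univ _)
  exact (Finset.sum_eq_zero_iff_of_nonneg fun l _ => tri_cutVec_nonneg G S k l).1 h1 l
    (Finset.mem_univ _)

/-- The coefficient vector `c` with `c · x = -Φ(x)`. [folklore] -/
private def cvec : (suspension G).edgeSet → ℝ :=
  fun e => -Phi G (fun j => if e = j then 1 else 0)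

/-- Helper for the proof of Theorem 13. [folklore] -/
private theorem cvec_dotProduct (x : (suspension G).edgeSet → ℝ) : cvec G ⬝ᵥ x = -Phi G x := by
  rw [LinearMap.pi_apply_eq_sum_univ (Phi G) x, dotProduct]
  simp only [cvec, smul_eq_mul, neg_mul, Finset.sum_neg_distrib]
  congr 1
  exact Finset.sum_congr rfl fun e _ => by ring

/-! #### `STAB(G) ⊆ π(F)` -/

/-- The lifted cut of a stable set lies on the face: every `h_e` vanishes. [cite: AvisTiwary2015, Thm. 13 proof (p0013 L60–62)] -/
private theorem Phi_cutVec_liftSet (S : StableSets G) : Phi G (cutVec (suspension G) (liftSet S.1)) = 0 := by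
  rw [Phi_apply]
  refine Finset.sum_eq_zero fun k _ => Finset.sum_eq_zero fun l _ => ?_
  by_cases h : G.Adj k l
  · rw [tri_apply_of_adj G h, cutVec_apexE, cutVec_apexE, cutVec_liftE]
    have hst : ¬ (k ∈ S.1 ∧ l ∈ S.1) := fun hh => S.2 k hh.1 l hh.2 h
    by_cases hk : k ∈ S.1
    · by_cases hl : l ∈ S.1
      · exact (hst ⟨hk, hl⟩).elim
      · simp [none_not_mem_liftSet, some_mem_liftSet, hk, hl]
    · by_cases hl : l ∈ S.1 <;> simp [none_not_mem_liftSet, some_mem_liftSet, hk, hl]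
  · rw [tri_apply_of_not_adj G h]

/-- Helper for the proof of Theorem 13. [folklore] -/
private theorem stab_subset :
    stabPolytope G ⊆ proj G '' (cutPolytope (suspension G) ∩ {x | cvec G ⬝ᵥ x = 0}) := by
  have hlin : IsLinearMap ℝ (fun z : (suspension G).edgeSet → ℝ => cvec G ⬝ᵥ z) :=
    ⟨fun u v => dotProduct_add _ _ _, fun s u => dotProduct_smul s (cvec G) u⟩
  have hconv : Convex ℝ (proj G '' (cutPolytope (suspension G) ∩ {x | cvec G ⬝ᵥ x = 0})) :=
    ((convex_cutPolytope _).inter (convex_hyperplane hlin 0)).linear_image _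
  refine convexHull_min ?_ hconv
  rintro _ ⟨S, rfl⟩
  refine ⟨cutVec (suspension G) (liftSet S.1), ⟨cutVec_mem_cutPolytope _ _, ?_⟩,
    proj_cutVec_liftSet G S⟩
  show cvec G ⬝ᵥ _ = 0
  rw [cvec_dotProduct, Phi_cutVec_liftSet, neg_zero]

/-! #### `π(F) ⊆ STAB(G)` -/

/-- A stable-set vector attached to every point: the one read off `y` when that set is stable,
the empty stable set otherwise (only used where the first case applies). [folklore] -/
private def stabPt (y : (suspension G).edgeSet → ℝ) : Fin n → ℝ :=
  if h : ∀ i ∈ readSet G y, ∀ j ∈ readSet G y, ¬ G.Adj i j then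
    stableSetVector (⟨readSet G y, h⟩ : StableSets G)
  else stableSetVector (⟨∅, by simp⟩ : StableSets G)

/-- Helper for the proof of Theorem 13. [folklore] -/
private theorem stabPt_mem (y : (suspension G).edgeSet → ℝ) : stabPt G y ∈ stabPolytope G := by
  unfold stabPt
  split_ifs <;> exact stableSetVector_mem_stabPolytope _

/-- On a cut vector with `Φ = 0` the read-off set is stable. [folklore] -/
private theorem readSet_stable {S : Finset (Option (Fin n))} (h0 : Phi G (cutVec (suspension G) S) = 0) :
    ∀ i ∈ readSet G (cutVec (suspension G) S), ∀ j ∈ readSet G (cutVec (suspension G) S),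
      ¬ G.Adj i j := by
  intro i hi j hj hij
  simp only [readSet, Finset.mem_filter, Finset.mem_univ, true_and] at hi hj
  have ht := tri_cutVec_eq_zero_of_Phi G h0 i j
  rw [tri_apply_of_adj G hij, hi, hj] at ht
  rcases cutVec_zero_or_one (suspension G) S (liftE G i j hij) with h | h
  · rw [h] at ht; norm_num at ht
  · rw [h] at ht; norm_num at ht

/-- On a cut vector with `Φ = 0`, the projection is the stable-set vector of the read-off set. [folklore] -/
private theorem proj_cutVec_eq_stabPt {S : Finset (Option (Fin n))} (h0 : Phi G (cutVec (suspension G) S) = 0) :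
    proj G (cutVec (suspension G) S) = stabPt G (cutVec (suspension G) S) := by
  rw [stabPt, dif_pos (readSet_stable G h0)]
  funext i
  rw [proj_apply]
  show _ = if i ∈ readSet G (cutVec (suspension G) S) then (1 : ℝ) else 0
  simp only [readSet, Finset.mem_filter, Finset.mem_univ, true_and]
  rcases cutVec_zero_or_one (suspension G) S (apexE G i) with h | h <;> simp [h]

/-- Helper for the proof of Theorem 13. [folklore] -/
private theorem proj_subset :
    proj G '' (cutPolytope (suspension G) ∩ {x | cvec G ⬝ᵥ x = 0}) ⊆ stabPolytope G := by
  classical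
  rintro _ ⟨x, ⟨hx, hface⟩, rfl⟩
  have hface' : Phi G x = 0 := by
    have h1 : cvec G ⬝ᵥ x = 0 := hface
    rw [cvec_dotProduct] at h1
    linarith
  -- write `x` as a convex combination of cut vectors
  have hrange : Set.range (cutVec (suspension G)) =
      ((Finset.univ.image (cutVec (suspension G)) : Finset _) : Set _) := by
    simp
  have hx' := hx
  rw [cutPolytope, hrange, Finset.convexHull_eq, Set.mem_setOf_eq] at hx'
  obtain ⟨w, hw0, hw1, hcm⟩ := hx'
  set Pts := Finset.univ.image (cutVec (suspension G)) with hPts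
  rw [Finset.centerMass_eq_of_sum_1 _ _ hw1] at hcm
  simp only [id] at hcm
  -- every point of `Pts` is a cut vector
  have hPt : ∀ y ∈ Pts, ∃ S, cutVec (suspension G) S = y := fun y hy => by
    simpa [hPts] using hy
  -- face condition forces `Φ = 0` on the support
  have hsum0 : ∑ y ∈ Pts, w y * Phi G y = 0 := by
    have : Phi G x = ∑ y ∈ Pts, w y * Phi G y := by
      rw [← hcm, map_sum]
      exact Finset.sum_congr rfl fun y _ => by rw [LinearMap.map_smul, smul_eq_mul]
    rw [← this, hface']
  have hnn : ∀ y ∈ Pts, 0 ≤ w y * Phi G y := fun y hy => by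
    obtain ⟨S, rfl⟩ := hPt y hy
    exact mul_nonneg (hw0 _ hy) (Phi_cutVec_nonneg G S)
  have hzero := (Finset.sum_eq_zero_iff_of_nonneg hnn).1 hsum0
  -- hence `w y • π y = w y • stabPt y` termwise
  have hterm : ∀ y ∈ Pts, w y • proj G y = w y • stabPt G y := fun y hy => by
    obtain ⟨S, rfl⟩ := hPt y hy
    by_cases hw : w (cutVec (suspension G) S) = 0
    · simp [hw]
    · have h0 : Phi G (cutVec (suspension G) S) = 0 := by
        rcases mul_eq_zero.1 (hzero _ hy) with h | h
        · exact (hw h).elim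
        · exact h
      rw [proj_cutVec_eq_stabPt G h0]
  have hpx : proj G x = ∑ y ∈ Pts, w y • stabPt G y := by
    rw [← hcm, map_sum]
    refine Finset.sum_congr rfl fun y hy => ?_
    rw [LinearMap.map_smul, hterm y hy]
  rw [hpx]
  exact (convex_stabPolytope G).sum_mem hw0 hw1 fun y _ => stabPt_mem G y

end Valid

end AvisTiwary2015Thm13

/-- **Avis–Tiwary 2015, Theorem 13 — PROVED**: with `c · x = -Σ_{k∼l}(x_{0k} + x_{0l} - x_{kl})`
(valid, `≤ 0`, on `CUT□(G')`) and `π` the projection onto the apex coordinates,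
`STAB(G) = π(CUT□(G') ∩ {c · x = 0})`, following the printed proof. [cite: AvisTiwary2015, Thm. 13 (§4.2; p0013 L48–62)] -/
theorem AvisTiwary2015_thm13_holds : AvisTiwary2015_thm13 := by
  intro n G _
  refine ⟨AvisTiwary2015Thm13.cvec G, 0, fun x hx => ?_, AvisTiwary2015Thm13.proj G,
    Set.Subset.antisymm (AvisTiwary2015Thm13.stab_subset G) (AvisTiwary2015Thm13.proj_subset G)⟩
  rw [AvisTiwary2015Thm13.cvec_dotProduct]
  have := AvisTiwary2015Thm13.Phi_nonneg_of_mem G hx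
  linarith

/-- **`xc(STAB(G)) ≤ xc(CUT□(G'))`** for the suspension `G'` of `G` — Theorem 13 combined with
Propositions 1 and 2 ("If `P` is a projection of `Q` then `xc(P) ≤ xc(Q)`"; "If `P` is a face of
`Q` then `xc(P) ≤ xc(Q)`"), the step used in the printed proof of Theorem 14: every size `r` of an
extended formulation of `CUT□(G')` is one of `STAB(G)`. PROVED (Thm. 13 above, faces by
`HasEFOfSize.inter_eqs`, linear images losslessly by `HasEFOfSize.image_linearMap`).
[cite: AvisTiwary2015, Props. 1–2 (p0006 L108–110) with Thm. 13 (p0013 L48–50), as used in the proof of Thm. 14 (p0013 L72–75)] -/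
theorem hasEFOfSize_stabPolytope_of_suspension {n : ℕ} (G : SimpleGraph (Fin n)) [DecidableRel G.Adj]
    {r : ℕ} (h : HasEFOfSize (cutPolytope (suspension G)) r) : HasEFOfSize (stabPolytope G) r := by
  obtain ⟨c, δ, -, π, hπ⟩ := AvisTiwary2015_thm13_holds n G
  have h1 := (h.inter_eqs (T := Unit) (fun _ => c) (fun _ => δ)).image_linearMap π
  rw [hπ]
  convert h1 using 3
  ext x
  simp

end Literature.Combinatorics.Optimization
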